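import Literature.Probability.Percolation.ArmSeparationOuterFail
import Literature.Probability.Percolation.ArmSeparationFenceBoundAt
import HarnessLib

/-!
# Outer separation at a general density `p`: the failure event is unlikely and lives outside `Λ_M`

Topic: Probability / Percolation; family `crit-perc` / near-critical percolation on `𝕋`
(`P_p = triSitePercolation p`, ANY `p : unitInterval`). `ArmSeparationOuterFail.lean` bounds the
probability of the failure event of Kesten's separation step around `∂Λ_{2M}` — `OutFail M T k₀ K`
behind side `0` for one colour, and `¬ OutGood M T k₀ K` = some of the twelve rotated /
colour-exchanged configurations fails (`ArmSeparationOuter.lean`) — at `p = 1/2` only, where the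
two colours have the same law. Nolin's separation theorem (2008, Thm. 11 [arXiv 0711.4948:
Thm. 10]) is stated "uniformly in `p`, `P̂` between `P_p` and `P_{1-p}`, `n ≤ N ≤ L(p)`"; at a
general `p` the closed colour of `P_p` has the law of the open colour of `P_{1-p}`
(`sitePercolation_real_preimage_compl`), so the twelve-fold union bound splits into six rotated
copies at `p` and six at `1 - p`. This file re-runs `ArmSeparationOuterFail.lean` accordingly, on
top of the general-`p` per-side estimate `real_trapSeparation_fail_le_at`
(`ArmSeparationFenceBoundAt.lean`):

* `real_setOf_outFail_le_at` — `P_p(OutFail) ≤ (1 - c₄)^{T+1} + T (1 - c_F²)^K`, given open frames of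
  probability `≥ c_F` at `p` (scales `< M`) and `c₄ ≤ P_{1-p}(LR(4(M-1), M-1))`;
* `real_setOf_outFail_rotConfig_at` / `real_setOf_outFail_rotConfig_compl_at` — rotation invariance
  at `p`; the colour-exchanged failure has probability `P_{1-p}(OutFail)`;
* `real_setOf_not_outGood_le_mul_at` — `P_p(¬ OutGood) ≤ 6 (P_p(OutFail) + P_{1-p}(OutFail))`;
* `real_setOf_not_outGood_le_at` — hence `P_p(¬ OutGood) ≤ 12 ((1 - c₄)^{T+1} + T (1 - c_F²)^K)` when
  the frame / RSW hypotheses hold at BOTH `p` and `1 - p` (below `L(p)` both do, Nolin §3.1);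
* `real_inter_setOf_not_outGood_at` — independence from events of `Λ_M`, at every `p`.

The events and their locality (`determinedBy_setOf_not_outGood`, `disjoint_outGoodFinset_triBall`)
are those of `ArmSeparationOuterFail.lean`, imported. Everything here is proved; no named facts
are introduced.

## References

* P. Nolin, *Near-critical percolation in two dimensions*, Electron. J. Probab. 13 (2008), Thm. 11
  and §4.4 [arXiv 0711.4948: Thm. 10, proof, first step; Lemma 14, (4.20)]. [Nolin2008]
* H. Kesten, *Scaling relations for 2D-percolation*, Comm. Math. Phys. 109 (1987), Lemma 2. [Kesten1987]
* W. Werner, *Lectures on two-dimensional critical percolation*, PCMI (2009), Lecture 6, Prop. 6.1. [WernerPCMI2009]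

Tree: `OutFail`, `OutGood` (`ArmSeparationOuter.lean`); `real_trapSeparation_fail_le_at`
(`ArmSeparationFenceBoundAt.lean`); `determinedBy_setOf_not_outGood`, `disjoint_outGoodFinset_triBall`
(`ArmSeparationOuterFail.lean`); `real_preimage_rotConfig`, `rotConfig_compl`
(`ArmSeparationRotate.lean`); `sitePercolation_real_preimage_compl` (`TriHexLemma.lean`);
`sitePercolation_real_inter_of_disjoint` (`SitePercolationMeasure.lean`).
-/

noncomputable section

open MeasureTheory Set
open scoped unitInterval

namespace Literature.Probability.Percolation

open LatticeModels

/-! ### Probability of failure at density `p` -/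

/-- **`P_p(OutFail) ≤ (1 - c₄)^{T+1} + T (1 - c_F²)^K`** at any density `p` (`M ≥ 3`,
`16 k_j + 1 ≤ M` for all scales), given open frames of probability `≥ c_F ∈ (0, 1]` at `p` at the
scales `< M` and `c₄ ≤ P_{1-p}(LR(4(M-1), M-1))`: the failure event is contained in
`{lowestSeq T ≠ none} ∪ ⋃_{u<T} {TrapSeqFail u}` (`real_trapSeparation_fail_le_at`). [cite: Nolin2008, §4.4 Lemma 15 (arXiv 0711.4948: Lemma 14, (4.20)), with Thm. 11 "uniformly in p"] -/
theorem real_setOf_outFail_le_at (p : unitInterval) {cF c₄ : ℝ} (hcF : 0 < cF) (hcF1 : cF ≤ 1) {M : ℕ}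
    (hF : ∀ (z : Site 2) (k : ℕ), 1 ≤ k → k < M → cF ≤ (triSitePercolation p).real (triFrameAt z k))
    (hM : 3 ≤ M) (hc₄ : c₄ ≤ triLRCrossingProb (σ p) (4 * (M - 1)) (M - 1))
    {T k₀ K : ℕ} (hk₀ : 1 ≤ k₀) (hKM : ∀ j < K, 16 * (trapScale k₀ j : ℤ) + 1 ≤ M) :
    (triSitePercolation p).real {χ | OutFail M T k₀ K χ} ≤ (1 - c₄) ^ (T + 1) + T * (1 - cF ^ 2) ^ K := by
  have hsub : {χ | OutFail M T k₀ K χ} ⊆ {χ | (trapDomain M).lowestSeq χ T ≠ none} ∪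
      ⋃ u ∈ Finset.range T, {χ | TrapSeqFail M u k₀ K χ} := by
    rintro χ (h | ⟨u, hu, h⟩)
    · exact Or.inl h
    · refine Or.inr ?_
      simp only [Set.mem_iUnion, Set.mem_setOf_eq]
      exact ⟨u, Finset.mem_range.2 hu, h⟩
  refine (measureReal_mono hsub (measure_ne_top _ _)).trans ?_
  refine (measureReal_union_le _ _).trans ?_
  refine le_trans (add_le_add le_rfl (measureReal_biUnion_finset_le _ _)) ?_
  exact real_trapSeparation_fail_le_at p hcF hcF1 hF hM hc₄ hk₀ hKM

/-- Failure in a rotated frame has the same probability, at every `p`. [folklore] -/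
theorem real_setOf_outFail_rotConfig_at (p : unitInterval) (M T k₀ K i : ℕ) :
    (triSitePercolation p).real {ω | OutFail M T k₀ K (rotConfig i ω)} =
      (triSitePercolation p).real {χ | OutFail M T k₀ K χ} :=
  real_preimage_rotConfig p i {χ | OutFail M T k₀ K χ}

/-- Failure of the complementary colour in a rotated frame has, at density `p`, the probability of
failure at the dual density `1 - p` (`P_p(ωᶜ ∈ E) = P_{1-p}(E)`). [cite: BollobasRiordan2006, Ch. 5 Lemma 7] -/
theorem real_setOf_outFail_rotConfig_compl_at (p : unitInterval) (M T k₀ K i : ℕ) :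
    (triSitePercolation p).real {ω | OutFail M T k₀ K (rotConfig i ω)ᶜ} =
      (triSitePercolation (σ p)).real {χ | OutFail M T k₀ K χ} := by
  have hset : {ω : SiteConfig (Site 2) | OutFail M T k₀ K (rotConfig i ω)ᶜ} =
      compl ⁻¹' (rotConfig i ⁻¹' {χ | OutFail M T k₀ K χ}) := by
    ext ω
    simp only [Set.mem_setOf_eq, Set.mem_preimage, rotConfig_compl]
  rw [hset]
  unfold triSitePercolation
  rw [sitePercolation_real_preimage_compl]
  exact real_preimage_rotConfig (σ p) i {χ | OutFail M T k₀ K χ}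

/-- **`P_p(¬ OutGood) ≤ 6 (P_p(OutFail) + P_{1-p}(OutFail))`**: union bound over the six frames and
the two colours, the closed colour of `P_p` having the law of the open colour of `P_{1-p}`. [cite: Nolin2008, §4.4 (arXiv 0711.4948: proof of Thm. 10, first step), with Thm. 11 "uniformly in p"] -/
theorem real_setOf_not_outGood_le_mul_at (p : unitInterval) (M T k₀ K : ℕ) :
    (triSitePercolation p).real {ω | ¬ OutGood M T k₀ K ω} ≤
      6 * ((triSitePercolation p).real {χ | OutFail M T k₀ K χ} +
        (triSitePercolation (σ p)).real {χ | OutFail M T k₀ K χ}) := by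
  set μ := triSitePercolation p with hμ
  have hsub : {ω | ¬ OutGood M T k₀ K ω} ⊆ ⋃ i ∈ Finset.range 6,
      ({ω | OutFail M T k₀ K (rotConfig i ω)} ∪ {ω | OutFail M T k₀ K (rotConfig i ω)ᶜ}) := by
    intro ω hω
    simp only [OutGood, Set.mem_setOf_eq, not_forall, not_and_or, not_not, exists_prop] at hω
    obtain ⟨i, hi, h⟩ := hω
    simp only [Set.mem_iUnion, Set.mem_union, Set.mem_setOf_eq]
    exact ⟨i, Finset.mem_range.2 hi, h⟩
  calc μ.real {ω | ¬ OutGood M T k₀ K ω}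
      ≤ μ.real (⋃ i ∈ Finset.range 6, ({ω | OutFail M T k₀ K (rotConfig i ω)} ∪ {ω | OutFail M T k₀ K (rotConfig i ω)ᶜ})) :=
        measureReal_mono hsub (measure_ne_top _ _)
    _ ≤ ∑ i ∈ Finset.range 6, μ.real ({ω | OutFail M T k₀ K (rotConfig i ω)} ∪ {ω | OutFail M T k₀ K (rotConfig i ω)ᶜ}) :=
        measureReal_biUnion_finset_le _ _
    _ ≤ ∑ i ∈ Finset.range 6, ((triSitePercolation p).real {χ | OutFail M T k₀ K χ} +
          (triSitePercolation (σ p)).real {χ | OutFail M T k₀ K χ}) := by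
        refine Finset.sum_le_sum fun i _ => ?_
        refine (measureReal_union_le _ _).trans ?_
        rw [hμ, real_setOf_outFail_rotConfig_at, real_setOf_outFail_rotConfig_compl_at]
    _ = 6 * ((triSitePercolation p).real {χ | OutFail M T k₀ K χ} +
          (triSitePercolation (σ p)).real {χ | OutFail M T k₀ K χ}) := by
        rw [Finset.sum_const, Finset.card_range, nsmul_eq_mul]; ring

/-- **`P_p(¬ OutGood) ≤ 12 ((1 - c₄)^{T+1} + T (1 - c_F²)^K)`** — the "`(4δ)`" of Nolin's first
step at a general density `p`, small once `T` and then `K` are large — given, at BOTH densities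
`q ∈ {p, 1 - p}`, open frames of probability `≥ c_F ∈ (0, 1]` at the scales `< M` and the RSW bound
`c₄ ≤ P_{1-q}(LR(4(M-1), M-1))` (both hold below `L(p)`, Nolin 2008, §3.1, (3.5)–(3.6)). [cite: Nolin2008, §4.4 (arXiv 0711.4948: proof of Thm. 10, first step), with Thm. 11 "uniformly in p"] -/
theorem real_setOf_not_outGood_le_at (p : unitInterval) {cF c₄ : ℝ} (hcF : 0 < cF) (hcF1 : cF ≤ 1) {M : ℕ}
    (hF : ∀ q : unitInterval, (q = p ∨ q = σ p) →
      ∀ (z : Site 2) (k : ℕ), 1 ≤ k → k < M → cF ≤ (triSitePercolation q).real (triFrameAt z k))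
    (hM : 3 ≤ M)
    (hc₄ : ∀ q : unitInterval, (q = p ∨ q = σ p) → c₄ ≤ triLRCrossingProb q (4 * (M - 1)) (M - 1))
    {T k₀ K : ℕ} (hk₀ : 1 ≤ k₀) (hKM : ∀ j < K, 16 * (trapScale k₀ j : ℤ) + 1 ≤ M) :
    (triSitePercolation p).real {ω | ¬ OutGood M T k₀ K ω} ≤ 12 * ((1 - c₄) ^ (T + 1) + T * (1 - cF ^ 2) ^ K) := by
  have h1 := real_setOf_outFail_le_at p hcF hcF1 (hF p (Or.inl rfl)) hM (hc₄ (σ p) (Or.inr rfl)) (T := T) hk₀ hKM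
  have hc₄' : c₄ ≤ triLRCrossingProb (σ (σ p)) (4 * (M - 1)) (M - 1) := by
    rw [unitInterval.symm_symm]; exact hc₄ p (Or.inl rfl)
  have h2 := real_setOf_outFail_le_at (σ p) hcF hcF1 (hF (σ p) (Or.inr rfl)) hM hc₄' (T := T) hk₀ hKM
  refine (real_setOf_not_outGood_le_mul_at p M T k₀ K).trans ?_
  linarith

/-! ### Independence from the inside, at density `p` -/

/-- **Independence from the inside at density `p`**: for an event `A` determined by the sites of
`Λ_M` (such as an arm event `armEvent κ n M`), `P_p(A ∩ {¬ OutGood}) = P_p(A) · P_p(¬ OutGood)`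
(`R < M`, `2 k_j + 1 ≤ R` for all scales), for every product measure `P_p`. [cite: Nolin2008, §4.4 (arXiv 0711.4948: proof of Thm. 10, "by independence of the two latter events")] -/
theorem real_inter_setOf_not_outGood_at (p : unitInterval) {M T k₀ K R : ℕ} (hM : 1 ≤ M)
    (hR : ∀ j < K, 2 * trapScale k₀ j + 1 ≤ R) (hRM : R < M) {A : Set (SiteConfig (Site 2))}
    (hA : DeterminedBy A ↑(triBall M)) :
    (triSitePercolation p).real (A ∩ {ω | ¬ OutGood M T k₀ K ω}) =
      (triSitePercolation p).real A * (triSitePercolation p).real {ω | ¬ OutGood M T k₀ K ω} := by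
  unfold triSitePercolation
  exact sitePercolation_real_inter_of_disjoint p hA (determinedBy_setOf_not_outGood hM hR)
    (disjoint_outGoodFinset_triBall hRM).symm

/-- **The step inequality behind the outer surgery, for ANY event split by `OutGood`, at density
`p`**: if `E ⊆ G ∪ ({¬ OutGood} ∩ A)` with `A` determined by `Λ_M` (the arm event one scale down)
then `P_p(E) ≤ P_p(G) + P_p(¬ OutGood) · P_p(A)` (Nolin 2008, §4.4, first display of the proof of
Thm. 11: `P(A(2^k, 2^K)) ≤ P(Ã(2^k, 2^K)) + 4δ · P(A(2^k, 2^{K-1}))`, "by independence"; Kesten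
1987, Lemma 2). The arity of the arm event only enters through the deterministic inclusion. [cite: Nolin2008, §4.4 (arXiv 0711.4948: proof of Thm. 10, first display); Kesten1987, Lemma 2] -/
theorem real_le_out_step_at (p : unitInterval) {M T k₀ K : ℕ} (hM : 2 ≤ M)
    (hKM : ∀ j < K, 2 * trapScale k₀ j + 2 ≤ M) {E G A : Set (SiteConfig (Site 2))}
    (hA : DeterminedBy A ↑(triBall M)) (hsub : E ⊆ G ∪ ({ω | ¬ OutGood M T k₀ K ω} ∩ A)) :
    (triSitePercolation p).real E ≤
      (triSitePercolation p).real G +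
        (triSitePercolation p).real {ω | ¬ OutGood M T k₀ K ω} * (triSitePercolation p).real A := by
  have hind := real_inter_setOf_not_outGood_at p (T := T) (k₀ := k₀) (K := K) (R := M - 1) (le_trans (by norm_num) hM)
    (fun j hj => by have := hKM j hj; omega) (by omega) hA
  calc (triSitePercolation p).real E
      ≤ (triSitePercolation p).real (G ∪ ({ω | ¬ OutGood M T k₀ K ω} ∩ A)) :=
        measureReal_mono hsub (measure_ne_top _ _)
    _ ≤ (triSitePercolation p).real G + (triSitePercolation p).real ({ω | ¬ OutGood M T k₀ K ω} ∩ A) :=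
        measureReal_union_le _ _
    _ = _ := by rw [Set.inter_comm, hind, mul_comm]

end Literature.Probability.Percolation
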